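import Summits.Ventures.PercRepro.ProfilePointedCircuitClassesStarSharpS
import Summits.Ventures.PercRepro.ProfilePointedParallel

/-! # The parallel-twin-of-`e` regime of `StarNineSharp`: reduction to a factor-two count (p5 g53, §80 ADD 9)

`StarNineSharp` (ProfilePointedCircuitClassesStarSharpC) asks, for a nine-point rank-5 cogirth-5 `N` with a series
pair `{b, b′}`, the two-point inequality `in_4(e) + thru_4({b′, f}) + thru_4({b′, e, f}) ≤ in_4(f) + thru_4({e, f}) +
thru_4({b′, e})`, i.e. (`inCount_thru_split`) `#{W ∈ BI_4(N) : e ∈ W ∌ f, b′ ∉ W} ≤ #{W : f ∈ W, b′ ∉ W}`.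

Here `e` has a parallel twin `x` (`rk N {e, x} = 1`, `x ≠ f, b′`).  Every `W ∈ BI_k(N)` then contains EXACTLY ONE of
`e, x` (`W` is independent, `gr N − W` is a basis — neither may contain the parallel pair), and the swap `e ↔ x` is a
bijection of `BI_k(N)` preserving `f ∈ W` and `b′ ∉ W` (the lemmas of ProfilePointedCircuitClassesStarSharpP, restated here under primed names because this file imports only StarSharpS and ProfilePointedParallel).  Hence
`#{W : f ∈ W, b′ ∉ W} = 2·#{W : e ∈ W, f ∈ W, b′ ∉ W}`, and the inequality of `StarNineSharp` at `(e, f)` is EQUIVALENT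
to the factor-two count `#{W : e ∈ W ∌ f, b′ ∉ W} ≤ 2·#{W : e, f ∈ W, b′ ∉ W}` — the (★)-inequality of the
contraction `N／e ∖ x` at level 3 (the «six-point lemma» of §80 ADD 7).  This file records the reduction; the count
itself is the open part (catalogue-true on all 3,596 D1 configurations of the eight-point catalogue). -/

open scoped Matroid

namespace PercRepro.Cogirth

open Finset ThmH Skew Shadow Profile

variable {α : Type} [DecidableEq α] {N : Matroid α} [N.Finite]

section StarSharpW

/-- **THE PARALLEL SWAP**: for a parallel pair `{f, y}` of non-loops and a bi-independent `k`-set `W ∋ y` with `f ∉ W`,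
the set `W − y + f` is bi-independent (`ρ(W − y + f) = ρ(W)`, `ρ((E ∖ W) − f + y) = ρ(E ∖ W)`). -/
theorem swap_mem_biIndepSets_of_parallel' {f y : α} (hf : f ∈ gr N) (hy : y ∈ gr N) (hfy' : f ≠ y)
    (hf1 : rk N {f} = 1) (hy1 : rk N {y} = 1) (hfy : rk N {f, y} = 1) {k : ℕ} {W : Finset α}
    (hW : W ∈ biIndepSets N k) (hyW : y ∈ W) (hfW : f ∉ W) :
    insert f (W.erase y) ∈ biIndepSets N k := by
  obtain ⟨hWg, hWc, hWr, hWcompl⟩ := mem_biIndepSets.1 hW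
  have hY : W.erase y ⊆ gr N := (erase_subset _ _).trans hWg
  have hfY : f ∉ W.erase y := fun h' => hfW (mem_of_mem_erase h')
  have hfc : f ∈ gr N \ W := mem_sdiff.2 ⟨hf, hfW⟩
  have hZ : (gr N \ W).erase f ⊆ gr N := (erase_subset _ _).trans sdiff_subset
  have hyZ : y ∉ (gr N \ W).erase f := fun h' => (mem_sdiff.1 (mem_of_mem_erase h')).2 hyW
  have hcompl : gr N \ insert f (W.erase y) = insert y ((gr N \ W).erase f) := by
    ext z
    simp only [mem_sdiff, mem_insert, mem_erase, not_or, not_and]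
    constructor
    · rintro ⟨hzg, hzf, hzW⟩
      by_cases hzy : z = y
      · exact Or.inl hzy
      · exact Or.inr ⟨hzf, hzg, hzW hzy⟩
    · rintro (rfl | ⟨hzf, hzg, hzW⟩)
      · exact ⟨hy, hfy'.symm, fun hzy => absurd rfl hzy⟩
      · exact ⟨hzg, hzf, fun _ => hzW⟩
  rw [mem_biIndepSets]
  refine ⟨insert_subset hf hY, ?_, ?_, ?_⟩
  · rw [card_insert_of_notMem hfY, card_erase_of_mem hyW]
    have := card_pos.2 ⟨y, hyW⟩
    omega
  · rw [rk_insert_eq_of_parallel' hf hy hf1 hy1 hfy hY, insert_erase hyW, hWr, card_insert_of_notMem hfY,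
      card_erase_of_mem hyW]
    have := card_pos.2 ⟨y, hyW⟩
    omega
  · rw [hcompl, rk_insert_eq_of_parallel' hy hf hy1 hf1 (by rw [pair_comm]; exact hfy) hZ, insert_erase hfc,
      hWcompl, card_insert_of_notMem hyZ, card_erase_of_mem hfc]
    have := card_pos.2 ⟨f, hfc⟩
    omega

/-- A bi-independent set contains at most one element of a parallel pair (it is independent). -/
theorem not_and_of_parallel' {f y : α} (hfy' : f ≠ y) (hfy : rk N {f, y} = 1) {k : ℕ} {W : Finset α}
    (hW : W ∈ biIndepSets N k) : ¬ (f ∈ W ∧ y ∈ W) := by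
  rintro ⟨hfW, hyW⟩
  exact not_pair_subset_of_parallel' hfy' hfy (mem_biIndepSets.1 hW).2.2.1
    (insert_subset hfW (singleton_subset_iff.2 hyW))

/-- A bi-independent set contains at least one element of a parallel pair of the ground set (its complement is
independent). -/
theorem mem_or_mem_of_parallel' {f y : α} (hf : f ∈ gr N) (hy : y ∈ gr N) (hfy' : f ≠ y) (hfy : rk N {f, y} = 1)
    {k : ℕ} {W : Finset α} (hW : W ∈ biIndepSets N k) : f ∈ W ∨ y ∈ W := by
  by_contra hcon
  rw [not_or] at hcon
  exact not_pair_subset_of_parallel' hfy' hfy (mem_biIndepSets.1 hW).2.2.2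
    (insert_subset (mem_sdiff.2 ⟨hf, hcon.1⟩) (singleton_subset_iff.2 (mem_sdiff.2 ⟨hy, hcon.2⟩)))

/-- **THE PARALLEL SWAP COUNT**: the bi-independent `k`-sets with `y ∈ W`, `f ∉ W` and a swap-invariant property `P`
are as many as those with `f ∈ W`, `y ∉ W` and `P`. -/
theorem card_filter_swap_of_parallel' {f y : α} (hf : f ∈ gr N) (hy : y ∈ gr N) (hfy' : f ≠ y)
    (hf1 : rk N {f} = 1) (hy1 : rk N {y} = 1) (hfy : rk N {f, y} = 1) (k : ℕ) (P : Finset α → Prop)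
    [DecidablePred P] (hP : ∀ W, P (insert f (W.erase y)) ↔ P W) (hP' : ∀ W, P (insert y (W.erase f)) ↔ P W) :
    ((biIndepSets N k).filter (fun W => (P W ∧ y ∈ W) ∧ f ∉ W)).card =
      ((biIndepSets N k).filter (fun W => (P W ∧ y ∉ W) ∧ f ∈ W)).card := by
  have hyf : rk N {y, f} = 1 := by rw [pair_comm]; exact hfy
  apply card_bij (fun W _ => insert f (W.erase y))
  · intro W hW
    rw [mem_filter] at hW ⊢
    obtain ⟨hWb, ⟨hPW, hyW⟩, hfW⟩ := hW
    exact ⟨swap_mem_biIndepSets_of_parallel' hf hy hfy' hf1 hy1 hfy hWb hyW hfW, ⟨(hP W).2 hPW,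
      fun h' => (mem_insert.1 h').elim (fun h'' => hfy' h''.symm) (fun h'' => (mem_erase.1 h'').1 rfl)⟩,
      mem_insert_self _ _⟩
  · intro W₁ hW₁ W₂ hW₂ heq
    rw [mem_filter] at hW₁ hW₂
    have heq' : insert f (W₁.erase y) = insert f (W₂.erase y) := heq
    have hf₁ : f ∉ W₁.erase y := fun h' => hW₁.2.2 (mem_of_mem_erase h')
    have hf₂ : f ∉ W₂.erase y := fun h' => hW₂.2.2 (mem_of_mem_erase h')
    have h1 : W₁.erase y = W₂.erase y := by
      rw [← erase_insert hf₁, ← erase_insert hf₂, heq']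
    rw [← insert_erase hW₁.2.1.2, ← insert_erase hW₂.2.1.2, h1]
  · intro V hV
    rw [mem_filter] at hV
    obtain ⟨hVb, ⟨hPV, hyV⟩, hfV⟩ := hV
    have hyV' : y ∉ V.erase f := fun h' => hyV (mem_of_mem_erase h')
    refine ⟨insert y (V.erase f), ?_, ?_⟩
    · rw [mem_filter]
      exact ⟨swap_mem_biIndepSets_of_parallel' hy hf hfy'.symm hy1 hf1 hyf hVb hfV hyV,
        ⟨(hP' V).2 hPV, mem_insert_self _ _⟩,
        fun h' => (mem_insert.1 h').elim (fun h'' => hfy' h'') (fun h'' => (mem_erase.1 h'').1 rfl)⟩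
    · show insert f ((insert y (V.erase f)).erase y) = V
      rw [erase_insert hyV', insert_erase hfV]

/-- When `e ∥ x` with `e, x ≠ f, b′`: `#{W ∈ BI_k(N) : f ∈ W, b′ ∉ W} = 2·#{W : e ∈ W, f ∈ W, b′ ∉ W}` — every `W`
contains exactly one of `e, x`, and the swap `e ↔ x` matches the `x`-half with the `e`-half. -/
theorem card_filter_f_eq_two_mul_of_parallel_twin (k : ℕ) {b' e f x : α} (he : e ∈ gr N) (hx : x ∈ gr N)
    (hex' : e ≠ x) (he1 : rk N {e} = 1) (hx1 : rk N {x} = 1) (hex : rk N {e, x} = 1) (hef : e ≠ f) (hxf : x ≠ f)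
    (heb' : e ≠ b') (hxb' : x ≠ b') :
    ((biIndepSets N k).filter (fun W => f ∈ W ∧ b' ∉ W)).card =
      2 * ((biIndepSets N k).filter (fun W => (e ∈ W ∧ f ∈ W) ∧ b' ∉ W)).card := by
  have h2 := card_filter_eq_sum_two (biIndepSets N k) (fun W => f ∈ W ∧ b' ∉ W) e
  have h3 : ((biIndepSets N k).filter (fun W => (f ∈ W ∧ b' ∉ W) ∧ e ∉ W)).card =
      ((biIndepSets N k).filter (fun W => ((f ∈ W ∧ b' ∉ W) ∧ x ∈ W) ∧ e ∉ W)).card := by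
    congr 1
    apply filter_congr
    intro W hW
    constructor
    · rintro ⟨hP, heW⟩
      exact ⟨⟨hP, (mem_or_mem_of_parallel' he hx hex' hex hW).resolve_left heW⟩, heW⟩
    · rintro ⟨⟨hP, _⟩, heW⟩
      exact ⟨hP, heW⟩
  have hinv : ∀ (u v : α), u ≠ f → v ≠ f → u ≠ b' → v ≠ b' → ∀ W : Finset α,
      (f ∈ insert u (W.erase v) ∧ b' ∉ insert u (W.erase v)) ↔ (f ∈ W ∧ b' ∉ W) := by
    intro u v huf hvf hub' hvb' W
    simp only [mem_insert, mem_erase, ne_eq]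
    have h1 : ¬ f = u := fun h => huf h.symm
    have h2 : ¬ b' = u := fun h => hub' h.symm
    have h3 : ¬ f = v := fun h => hvf h.symm
    have h4 : ¬ b' = v := fun h => hvb' h.symm
    tauto
  have h4 := card_filter_swap_of_parallel' he hx hex' he1 hx1 hex k (fun W => f ∈ W ∧ b' ∉ W)
    (hinv e x hef hxf heb' hxb') (hinv x e hxf hef hxb' heb')
  have h5 : ((biIndepSets N k).filter (fun W => ((f ∈ W ∧ b' ∉ W) ∧ x ∉ W) ∧ e ∈ W)).card =
      ((biIndepSets N k).filter (fun W => (e ∈ W ∧ f ∈ W) ∧ b' ∉ W)).card := by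
    congr 1
    apply filter_congr
    intro W hW
    constructor
    · rintro ⟨⟨⟨hfW, hb'W⟩, _⟩, heW⟩
      exact ⟨⟨heW, hfW⟩, hb'W⟩
    · rintro ⟨⟨heW, hfW⟩, hb'W⟩
      exact ⟨⟨⟨hfW, hb'W⟩, fun hxW => not_and_of_parallel' hex' hex hW ⟨heW, hxW⟩⟩, heW⟩
  have h6 : ((biIndepSets N k).filter (fun W => (f ∈ W ∧ b' ∉ W) ∧ e ∈ W)).card =
      ((biIndepSets N k).filter (fun W => (e ∈ W ∧ f ∈ W) ∧ b' ∉ W)).card := by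
    congr 1
    apply filter_congr
    intro W _
    tauto
  omega

/-- The inequality of `StarNineSharp` at `(e, f)` when `e` has a parallel twin `x ∉ {f, b′}`, given the factor-two
count `#{W : e ∈ W ∌ f, b′ ∉ W} ≤ 2·#{W : e, f ∈ W, b′ ∉ W}` (the six-point lemma of §80 ADD 7 in the vocabulary
of `N`; open in the kernel). -/
theorem inCount_thru_le_of_parallel_twin_e (k : ℕ) {b' e f x : α} (he : e ∈ gr N) (hx : x ∈ gr N)
    (hex' : e ≠ x) (he1 : rk N {e} = 1) (hx1 : rk N {x} = 1) (hex : rk N {e, x} = 1) (hef : e ≠ f) (hxf : x ≠ f)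
    (heb' : e ≠ b') (hxb' : x ≠ b')
    (hcore : ((biIndepSets N k).filter (fun W => (e ∈ W ∧ f ∉ W) ∧ b' ∉ W)).card ≤
      2 * ((biIndepSets N k).filter (fun W => (e ∈ W ∧ f ∈ W) ∧ b' ∉ W)).card) :
    inCount N k e + thruCount N k {b', f} + thruCount N k {b', e, f} ≤
      inCount N k f + thruCount N k {e, f} + thruCount N k {b', e} := by
  rw [inCount_thru_split', card_filter_f_eq_two_mul_of_parallel_twin k he hx hex' he1 hx1 hex hef hxf heb' hxb']
  exact hcore

/-- Conversely the inequality of `StarNineSharp` at `(e, f)` FORCES the factor-two count when `e ∥ x`: the two are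
equivalent, so the D1 regime of `StarNineSharp` is exactly the six-point lemma. -/
theorem parallel_twin_e_core_iff (k : ℕ) {b' e f x : α} (he : e ∈ gr N) (hx : x ∈ gr N)
    (hex' : e ≠ x) (he1 : rk N {e} = 1) (hx1 : rk N {x} = 1) (hex : rk N {e, x} = 1) (hef : e ≠ f) (hxf : x ≠ f)
    (heb' : e ≠ b') (hxb' : x ≠ b') :
    (inCount N k e + thruCount N k {b', f} + thruCount N k {b', e, f} ≤
      inCount N k f + thruCount N k {e, f} + thruCount N k {b', e}) ↔
    ((biIndepSets N k).filter (fun W => (e ∈ W ∧ f ∉ W) ∧ b' ∉ W)).card ≤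
      2 * ((biIndepSets N k).filter (fun W => (e ∈ W ∧ f ∈ W) ∧ b' ∉ W)).card := by
  rw [inCount_thru_split', card_filter_f_eq_two_mul_of_parallel_twin k he hx hex' he1 hx1 hex hef hxf heb' hxb']

end StarSharpW

end PercRepro.Cogirth
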